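import Summits.ResolutionOfSingularities.ResolutionOfSingularities.Theorems.PurelyInseparableDim4SwapTransportWindowCoreAnySigma
import Summits.ResolutionOfSingularities.ResolutionOfSingularities.Theorems.PurelyInseparableDim4SwapTransportTranslatedChainPrime
import Summits.ResolutionOfSingularities.ResolutionOfSingularities.Theorems.PurelyInseparableDim4ResConeCInfTranslatedStraightSigma
import Summits.ResolutionOfSingularities.ResolutionOfSingularities.Theorems.PurelyInseparableDim4SwapTransportWindowFrameSigma
import HarnessLib
import HarnessLib.Audit.Tags

/-!
# Purely inseparable four-folds — THE UNPINNED VIRTUAL CHAIN, EVERY σ = (n, n) + 0 AND EVERY PRIME: a real twin-slot chain in regime is shadowed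
# by a chain of TRANSLATED virtual slot steps carrying the straight σ-ledger frame, and a real SATELLITE step is a virtual LETTER CHANGE
# (cell `res-dim4-pi`, K2(p) lane, class (iii) rows σ = (n, n) + 0, flagless branch; the `1 ↦ n` edition of (I♭)+(ℓ-sat)
# `…SwapTransportTranslatedChainPrime` p728714; seat res-dim4-typ-1 g6)

[OURS · counted 0 · cell `res-dim4-pi` · K2(p) lane (holder res-dim4-p-12 g5, e = 3 MAP «class (iii) (2,2)+0 / (3,3)+0 flagless ⇒ regime R ⇒
`not_isIsolated_of_regimeR_of_le_five`»; res-dim4-p-3 g6 l.7164 «the σ-edition is typ-1's 1 ↦ n substitution»).]  Nothing here proves K2(p)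
for any `p`, any TAIL(p, d, 3), FLAGLESS♯, `NoIsolatedTrap p p` or resolution of singularities in dimension ≥ 4 / characteristic `p` — NOT proved.
AI kernel work, weaker than expert review.  Transport bookkeeping about OUR frame; kills nothing by itself.

* §1 **`virtual_letter_change_of_satellite_of_regime_sigma0`** — (ℓ-sat) in the twin-slot regime: a real SATELLITE step at `k + t` makes the
  next virtual chart differ, `ℓs (t+1) ≠ ℓs t` (the weight-free `virtual_letter_change_of_satellite` with `hone` from G1
  `step_cases_of_weights_sigma0`).
* §2 **`exists_virtual_translated_chain_sigma0`** — from a relation `(π₀, c k, B₀)` at precision `M` with `B₀` framed (order `p + n`,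
  `r = n·x_λ + n·x_μ ∣ F`, `resForm = a·x_f^d` + support dress, σ-ledger «`e_f ≤ d − 1 ⇒ e_λ, e_μ ≥ n + 1`», isolated, `e_G = 3`;
  `n + d = p`) and the real chain in regime up to `k + T + 1` (isolated with common certificate `Nc`, order `p + n`, `e_G = 3`, weights of degree
  `2n`, `x^r ∣`), `Nc + 2p + n + 1 + p·T ≤ M`: there are `πs, Bs, ℓs, βs` with `πs 0 = π₀`, `Bs 0 = B₀`, W5a's formulas for `ℓs`, `πs` at EVERY
  `t`, the TRANSLATED steps `Bs (t+1) = step p univ (ℓs t) (update 0 u (βs t)) (Bs t)` for `t ≤ T`, and at every `t ≤ T + 1` the relation at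
  precision `M − p·t`, the real weights along `πs t`, and the frame of `Bs t` — C♯σ `virtual_core_any_sigma0` per step, F1 σ-(VT-f)
  `translation_contact_eq_zero_sigma_free_of_eq` for the contact component, TSσ `translated_child_frame_sigma` for the child's frame; extend-and-update
  induction as in the light-pair edition.
[cite: Hauser2010, §§F–G] [cite: CossartJannsenSaito2020, Thm. 3.14]
bears_on: LADDER-RESOLUTION:D157-DOOR2 (res-dim4-pi · K2(p) · class (iii) σ = (n,n)+0 flagless branch: unpinned virtual chain).  Supports
stmt-ResolutionOfSingularities-16155 (helper).
-/


set_option linter.dupNamespace false -- mandated namespace of this single-conjunct summit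

noncomputable section

namespace Summit.ResolutionOfSingularities.ResolutionOfSingularities.Theorems.PIDim4

namespace SwapTransport

open MvPolynomial Finset
open Literature.AlgebraicGeometry.Resolution
open Literature.AlgebraicGeometry.Resolution.CentreBlowup
open Literature.AlgebraicGeometry.Resolution.Hauser2010
open Literature.AlgebraicGeometry.Resolution.HauserPerlega2019

variable {K : Type} [Field K] [DecidableEq K]

/-! ## §1 (ℓ-sat) in the twin-slot regime -/

/-- (ℓ-sat) in regime, σ = (n, n) + 0: `hone` from G1 `step_cases_of_weights_sigma0` (the real step `k + t + 1` keeps weights of degree `2n` from a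
state of order `p + n` with weights `n·e_{πs(t+1) λ} + n·e_{πs(t+1) μ}`). [OURS] [cite: Hauser2010, §§F–G] -/
theorem virtual_letter_change_of_satellite_of_regime_sigma0 (p : ℕ) {n : ℕ} (hn : 0 < n) {la mu u f : Fin 4} (hlm : la ≠ mu)
    (hlu : la ≠ u) (hlf : la ≠ f) (hmu : mu ≠ u) (hmf : mu ≠ f) (huf : u ≠ f) {c : ℕ → State K} {j : ℕ → Fin 4} {b : ℕ → Fin 4 → K}
    {k : ℕ} {πs : ℕ → Equiv.Perm (Fin 4)} {ℓs : ℕ → Fin 4}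
    (hℓs : ∀ t, ℓs t = if j (k + t) = πs t la then la else if j (k + t) = πs t mu then mu
      else if b (k + t) (πs t la) ≠ 0 then la else mu)
    (hπs : ∀ t, πs (t + 1) = if j (k + t) = πs t la ∨ j (k + t) = πs t mu then πs t
      else (Equiv.swap (ℓs t) ((πs t).symm (j (k + t)))).trans (πs t)) {t : ℕ}
    (hrA : (c (k + (t + 1))).r = Finsupp.single (πs (t + 1) la) n + Finsupp.single (πs (t + 1) mu) n)
    (hoA : ordZero (c (k + (t + 1))).F = ((p + n : ℕ) : ℕ∞))
    (hcs : c (k + (t + 2)) = CentreBlowup.step p Finset.univ (j (k + (t + 1))) (b (k + (t + 1))) (c (k + (t + 1))))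
    (hdeg : (c (k + (t + 2))).r.degree = 2 * n) (hsat : FreeTail.IsSatellite j b (k + t)) : ℓs (t + 1) ≠ ℓs t := by
  set π := πs (t + 1) with hπ
  have hπlm : π la ≠ π mu := fun h => hlm (π.injective h)
  have hπlu : π la ≠ π u := fun h => hlu (π.injective h)
  have hπlf : π la ≠ π f := fun h => hlf (π.injective h)
  have hπmu : π mu ≠ π u := fun h => hmu (π.injective h)
  have hπmf : π mu ≠ π f := fun h => hmf (π.injective h)
  have hπuf : π u ≠ π f := fun h => huf (π.injective h)
  rw [hcs] at hdeg
  refine virtual_letter_change_of_satellite hlm hℓs hπs (fun h1 h2 => ?_) hsat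
  rcases step_cases_of_weights_sigma0 p hn hπlm hπlu hπlf hπmu hπmf hπuf hrA hoA hdeg with
    ⟨hjr, -, -⟩ | ⟨hjr, -, -⟩ | ⟨-, hrot⟩
  · exact absurd hjr h1
  · exact absurd hjr h2
  · rcases hrot with ⟨hbla, -, -⟩ | ⟨hbmu, -, -⟩
    · exact Or.inl hbla
    · exact Or.inr hbmu

/-! ## §2 The unpinned virtual chain -/

/-- **THE UNPINNED VIRTUAL CHAIN, every σ = (n, n) + 0, every prime** (the `1 ↦ n` edition of (I♭); module docstring §2). [OURS]
[cite: Hauser2010, §§F–G] [cite: CossartJannsenSaito2020, Thm. 3.14] -/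
theorem exists_virtual_translated_chain_sigma0 (p : ℕ) [Fact p.Prime] [CharP K p] {n d : ℕ} (hσ : n + d = p) (hn : 0 < n)
    (hd2 : 2 ≤ d)
    {la mu u f : Fin 4} (hlm : la ≠ mu) (hlu : la ≠ u) (hlf : la ≠ f) (hmu : mu ≠ u) (hmf : mu ≠ f) (huf : u ≠ f)
    {c : ℕ → State K} {j : ℕ → Fin 4} {b : ℕ → Fin 4 → K} (hw : FreeTail.IsWitnessedChain p c j b) {k Nc T : ℕ}
    (hisoR : ∀ t, t ≤ T + 1 → IsIsolated p (c (k + t)).F)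
    (hcert : ∀ t, t ≤ T + 1 → originIdeal K ^ Nc ≤ singLocusIdeal p (c (k + t)).F ⊔ originIdeal K ^ (Nc + 1))
    (hoR : ∀ t, t ≤ T + 1 → ordZero (c (k + t)).F = ((p + n : ℕ) : ℕ∞))
    (he3R : ∀ t, t ≤ T + 1 → Module.finrank K (ResCone.resVertex (c (k + t))) = 3)
    (hwtR : ∀ t, t ≤ T + 1 → (c (k + t)).r.degree = 2 * n)
    (hdivR : ∀ t, t ≤ T + 1 → ∀ e ∈ (c (k + t)).F.support, (c (k + t)).r ≤ e)
    {π₀ : Equiv.Perm (Fin 4)} {B₀ : State K} {M : ℕ} (hM : Nc + 2 * p + n + 1 + p * T ≤ M)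
    (hrel0 : ∃ (θ e : Fin 4 → MvPolynomial (Fin 4) K) (U E : MvPolynomial (Fin 4) K),
      θ (π₀ la) = X la * e la ∧ θ (π₀ mu) = X mu * e mu ∧ constantCoeff (e la) ≠ 0 ∧ constantCoeff (e mu) ≠ 0 ∧
      constantCoeff (θ (π₀ u)) = 0 ∧ constantCoeff (θ (π₀ f)) = 0 ∧
      coeff (Finsupp.single u 1) (θ (π₀ u)) * coeff (Finsupp.single f 1) (θ (π₀ f)) -
        coeff (Finsupp.single f 1) (θ (π₀ u)) * coeff (Finsupp.single u 1) (θ (π₀ f)) ≠ 0 ∧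
      constantCoeff U ≠ 0 ∧ E ∈ originIdeal K ^ M ∧ B₀.F = deletePthPowers p (U ^ p * aeval θ (c k).F) + E)
    (hrA0 : (c k).r = Finsupp.single (π₀ la) n + Finsupp.single (π₀ mu) n)
    (hfr0 : ordZero B₀.F = ((p + n : ℕ) : ℕ∞) ∧ B₀.r = Finsupp.single la n + Finsupp.single mu n ∧
      (∀ e ∈ B₀.F.support, B₀.r ≤ e) ∧ (∃ a : K, a ≠ 0 ∧ ResCone.resForm B₀ = C a * X f ^ d) ∧
      (∀ e ∈ B₀.F.support, e.degree = p + n → e = Finsupp.single la n + Finsupp.single mu n + Finsupp.single u 0 + Finsupp.single f d) ∧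
      (∀ e ∈ B₀.F.support, e f ≤ d - 1 → n + 1 ≤ e la ∧ n + 1 ≤ e mu) ∧
      IsIsolated p B₀.F ∧ Module.finrank K (ResCone.resVertex B₀) = 3) :
    ∃ (πs : ℕ → Equiv.Perm (Fin 4)) (Bs : ℕ → State K) (ℓs : ℕ → Fin 4) (βs : ℕ → K), πs 0 = π₀ ∧ Bs 0 = B₀ ∧
      (∀ t, ℓs t = if j (k + t) = πs t la then la else if j (k + t) = πs t mu then mu
        else if b (k + t) (πs t la) ≠ 0 then la else mu) ∧
      (∀ t, πs (t + 1) = if j (k + t) = πs t la ∨ j (k + t) = πs t mu then πs t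
        else (Equiv.swap (ℓs t) ((πs t).symm (j (k + t)))).trans (πs t)) ∧
      (∀ t, t ≤ T → Bs (t + 1) = CentreBlowup.step p Finset.univ (ℓs t) (Function.update (0 : Fin 4 → K) u (βs t)) (Bs t)) ∧
      ∀ t, t ≤ T + 1 →
        (∃ (θ e : Fin 4 → MvPolynomial (Fin 4) K) (U E : MvPolynomial (Fin 4) K),
          θ (πs t la) = X la * e la ∧ θ (πs t mu) = X mu * e mu ∧ constantCoeff (e la) ≠ 0 ∧ constantCoeff (e mu) ≠ 0 ∧
          constantCoeff (θ (πs t u)) = 0 ∧ constantCoeff (θ (πs t f)) = 0 ∧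
          coeff (Finsupp.single u 1) (θ (πs t u)) * coeff (Finsupp.single f 1) (θ (πs t f)) -
            coeff (Finsupp.single f 1) (θ (πs t u)) * coeff (Finsupp.single u 1) (θ (πs t f)) ≠ 0 ∧
          constantCoeff U ≠ 0 ∧ E ∈ originIdeal K ^ (M - p * t) ∧
          (Bs t).F = deletePthPowers p (U ^ p * aeval θ (c (k + t)).F) + E) ∧
        (c (k + t)).r = Finsupp.single (πs t la) n + Finsupp.single (πs t mu) n ∧
        (ordZero (Bs t).F = ((p + n : ℕ) : ℕ∞) ∧ (Bs t).r = Finsupp.single la n + Finsupp.single mu n ∧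
          (∀ e ∈ (Bs t).F.support, (Bs t).r ≤ e) ∧ (∃ a : K, a ≠ 0 ∧ ResCone.resForm (Bs t) = C a * X f ^ d) ∧
          (∀ e ∈ (Bs t).F.support, e.degree = p + n →
            e = Finsupp.single la n + Finsupp.single mu n + Finsupp.single u 0 + Finsupp.single f d) ∧
          (∀ e ∈ (Bs t).F.support, e f ≤ d - 1 → n + 1 ≤ e la ∧ n + 1 ≤ e mu) ∧
          IsIsolated p (Bs t).F ∧ Module.finrank K (ResCone.resVertex (Bs t)) = 3) := by
  have hnp : n < p := by omega
  -- the recursion data `πs, ℓs` (total; the states of `exists_virtual_data_prime` are not used)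
  obtain ⟨πs, -, ℓs, hπ0, -, -, hℓs, hπs⟩ := exists_virtual_data_prime p j b k la mu π₀ B₀
  -- ONE translated virtual step from a framed virtual state related to the real state `c (k + q)`, `q ≤ T`
  have hone : ∀ q, q ≤ T → ∀ B : State K,
      (∃ (θ e : Fin 4 → MvPolynomial (Fin 4) K) (U E : MvPolynomial (Fin 4) K),
        θ (πs q la) = X la * e la ∧ θ (πs q mu) = X mu * e mu ∧ constantCoeff (e la) ≠ 0 ∧ constantCoeff (e mu) ≠ 0 ∧
        constantCoeff (θ (πs q u)) = 0 ∧ constantCoeff (θ (πs q f)) = 0 ∧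
        coeff (Finsupp.single u 1) (θ (πs q u)) * coeff (Finsupp.single f 1) (θ (πs q f)) -
          coeff (Finsupp.single f 1) (θ (πs q u)) * coeff (Finsupp.single u 1) (θ (πs q f)) ≠ 0 ∧
        constantCoeff U ≠ 0 ∧ E ∈ originIdeal K ^ (M - p * q) ∧
        B.F = deletePthPowers p (U ^ p * aeval θ (c (k + q)).F) + E) →
      (c (k + q)).r = Finsupp.single (πs q la) n + Finsupp.single (πs q mu) n →
      (ordZero B.F = ((p + n : ℕ) : ℕ∞) ∧ B.r = Finsupp.single la n + Finsupp.single mu n ∧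
        (∀ e ∈ B.F.support, B.r ≤ e) ∧ (∃ a : K, a ≠ 0 ∧ ResCone.resForm B = C a * X f ^ d) ∧
        (∀ e ∈ B.F.support, e.degree = p + n → e = Finsupp.single la n + Finsupp.single mu n + Finsupp.single u 0 + Finsupp.single f d) ∧
        (∀ e ∈ B.F.support, e f ≤ d - 1 → n + 1 ≤ e la ∧ n + 1 ≤ e mu) ∧
        IsIsolated p B.F ∧ Module.finrank K (ResCone.resVertex B) = 3) →
      ∃ β : K,
        (∃ (θ e : Fin 4 → MvPolynomial (Fin 4) K) (U E : MvPolynomial (Fin 4) K),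
          θ (πs (q + 1) la) = X la * e la ∧ θ (πs (q + 1) mu) = X mu * e mu ∧ constantCoeff (e la) ≠ 0 ∧ constantCoeff (e mu) ≠ 0 ∧
          constantCoeff (θ (πs (q + 1) u)) = 0 ∧ constantCoeff (θ (πs (q + 1) f)) = 0 ∧
          coeff (Finsupp.single u 1) (θ (πs (q + 1) u)) * coeff (Finsupp.single f 1) (θ (πs (q + 1) f)) -
            coeff (Finsupp.single f 1) (θ (πs (q + 1) u)) * coeff (Finsupp.single u 1) (θ (πs (q + 1) f)) ≠ 0 ∧
          constantCoeff U ≠ 0 ∧ E ∈ originIdeal K ^ (M - p * (q + 1)) ∧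
          (CentreBlowup.step p Finset.univ (ℓs q) (Function.update (0 : Fin 4 → K) u β) B).F =
            deletePthPowers p (U ^ p * aeval θ (c (k + (q + 1))).F) + E) ∧
        (c (k + (q + 1))).r = Finsupp.single (πs (q + 1) la) n + Finsupp.single (πs (q + 1) mu) n ∧
        (ordZero (CentreBlowup.step p Finset.univ (ℓs q) (Function.update (0 : Fin 4 → K) u β) B).F = ((p + n : ℕ) : ℕ∞) ∧
          (CentreBlowup.step p Finset.univ (ℓs q) (Function.update (0 : Fin 4 → K) u β) B).r = Finsupp.single la n + Finsupp.single mu n ∧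
          (∀ e ∈ (CentreBlowup.step p Finset.univ (ℓs q) (Function.update (0 : Fin 4 → K) u β) B).F.support,
            (CentreBlowup.step p Finset.univ (ℓs q) (Function.update (0 : Fin 4 → K) u β) B).r ≤ e) ∧
          (∃ a : K, a ≠ 0 ∧
            ResCone.resForm (CentreBlowup.step p Finset.univ (ℓs q) (Function.update (0 : Fin 4 → K) u β) B) = C a * X f ^ d) ∧
          (∀ e ∈ (CentreBlowup.step p Finset.univ (ℓs q) (Function.update (0 : Fin 4 → K) u β) B).F.support, e.degree = p + n →
            e = Finsupp.single la n + Finsupp.single mu n + Finsupp.single u 0 + Finsupp.single f d) ∧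
          (∀ e ∈ (CentreBlowup.step p Finset.univ (ℓs q) (Function.update (0 : Fin 4 → K) u β) B).F.support,
            e f ≤ d - 1 → n + 1 ≤ e la ∧ n + 1 ≤ e mu) ∧
          IsIsolated p (CentreBlowup.step p Finset.univ (ℓs q) (Function.update (0 : Fin 4 → K) u β) B).F ∧
          Module.finrank K (ResCone.resVertex (CentreBlowup.step p Finset.univ (ℓs q) (Function.update (0 : Fin 4 → K) u β) B)) = 3) := by
    intro q hqT B hrel hrA hfr
    obtain ⟨hoB, hrB, hdivB, ⟨a, ha, hformB⟩, hstrB, hledB, -, -⟩ := hfr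
    obtain ⟨-, hbj, -, -, hcs⟩ := hw (k + q)
    have hcs' : c (k + (q + 1)) = CentreBlowup.step p Finset.univ (j (k + q)) (b (k + q)) (c (k + q)) := hcs
    have hpq : p * q + p = p * (q + 1) := (Nat.mul_succ p q).symm
    have hpqT : p * q ≤ p * T := Nat.mul_le_mul_left p hqT
    obtain ⟨ℓ, π', b', hℓ, hℓeq, hπ'eq, hb'l, hb'm, hrel', hrA', ho', hr', hdiv', hiso', he3'⟩ :=
      virtual_core_any_sigma0 p hn hnp hlm hlu hlf hmu hmf huf hrel hrA (hoR q (by omega)) hoB hrB hdivB hbj hcs'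
        (hisoR (q + 1) (by omega)) (hcert (q + 1) (by omega)) (hoR (q + 1) (by omega)) (he3R (q + 1) (by omega))
        (hwtR (q + 1) (by omega)) (hdivR (q + 1) (by omega)) (by omega)
    have hℓq : ℓs q = ℓ := by rw [hℓs q, hℓeq]
    have hπq : πs (q + 1) = π' := by rw [hπs q, hπ'eq, hℓq]
    -- (VT-f): the contact component vanishes; `b′ = β·e_u`
    have hin : initialForm B.F = monomial (B.r + Finsupp.single f d) a := initialForm_eq_of_resForm_sigma hdivB hformB
    have hrdegB : B.r.degree + d = p + n := by rw [hrB, map_add, Finsupp.degree_single, Finsupp.degree_single]; omega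
    have hBf : B.r f = 0 := by
      rw [hrB, Finsupp.add_apply, Finsupp.single_eq_of_ne hlf.symm, Finsupp.single_eq_of_ne hmf.symm, add_zero]
    have hb'off : ∀ i, B.r i ≠ 0 → b' i = 0 := by
      intro i hi
      rcases ResCone.letters_exhaust hlm hlu hlf hmu hmf huf i with rfl | rfl | rfl | rfl
      · exact hb'l
      · exact hb'm
      · exact absurd (by rw [hrB, Finsupp.add_apply, Finsupp.single_eq_of_ne hlu.symm, Finsupp.single_eq_of_ne hmu.symm, add_zero]) hi
      · exact absurd hBf hi
    have hb'f : b' f = 0 := by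
      rcases hℓ with rfl | rfl
      · have hBℓ : B.r ℓ = n := by rw [hrB, Finsupp.add_apply, Finsupp.single_eq_same, Finsupp.single_eq_of_ne hlm, add_zero]
        exact translation_contact_eq_zero_sigma_free_of_eq p (by omega) hn hnp hlf hBf hBℓ hrdegB hoB ha hin hb'off ho'
      · have hBℓ : B.r ℓ = n := by rw [hrB, Finsupp.add_apply, Finsupp.single_eq_of_ne hlm.symm, Finsupp.single_eq_same, zero_add]
        exact translation_contact_eq_zero_sigma_free_of_eq p (by omega) hn hnp hmf hBf hBℓ hrdegB hoB ha hin hb'off ho'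
    set β := b' u with hβ
    have hb'eq : b' = Function.update (0 : Fin 4 → K) u β := eq_single_of_letters hlm hlu hlf hmu hmf huf hb'l hb'm hb'f
    rw [hb'eq] at hrel' ho' hr' hdiv' hiso' he3'
    -- TS: the translated child is framed
    have hframe : (∀ e ∈ (CentreBlowup.step p Finset.univ ℓ (Function.update (0 : Fin 4 → K) u β) B).F.support, e f ≤ d - 1 →
          n + 1 ≤ e la ∧ n + 1 ≤ e mu) ∧
        (∃ a : K, a ≠ 0 ∧ ResCone.resForm (CentreBlowup.step p Finset.univ ℓ (Function.update (0 : Fin 4 → K) u β) B) = C a * X f ^ d) ∧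
        (∀ e ∈ (CentreBlowup.step p Finset.univ ℓ (Function.update (0 : Fin 4 → K) u β) B).F.support, e.degree = p + n →
          e = Finsupp.single la n + Finsupp.single mu n + Finsupp.single u 0 + Finsupp.single f d) := by
      rcases hℓ with rfl | rfl
      · obtain ⟨-, -, hled₁, hform₁, hstr₁⟩ :=
          ResCone.translated_child_frame_sigma hlm hlu hlf hmu hmf huf p hσ hn hd2 hrB hdivB hoB hstrB hledB β ho' he3'
        exact ⟨hled₁, hform₁, hstr₁⟩
      · have hrBs : B.r = Finsupp.single ℓ n + Finsupp.single la n := by rw [hrB, add_comm]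
        have hstrBs : ∀ e ∈ B.F.support, e.degree = p + n →
            e = Finsupp.single ℓ n + Finsupp.single la n + Finsupp.single u 0 + Finsupp.single f d :=
          fun e he hdeg => (hstrB e he hdeg).trans (ResCone.cone_comm_sigma ℓ la u f n d)
        have hledBs : ∀ e ∈ B.F.support, e f ≤ d - 1 → n + 1 ≤ e ℓ ∧ n + 1 ≤ e la := fun e he hf => (hledB e he hf).symm
        obtain ⟨-, -, hled₁, hform₁, hstr₁⟩ :=
          ResCone.translated_child_frame_sigma hlm.symm hmu hmf hlu hlf huf p hσ hn hd2 hrBs hdivB hoB hstrBs hledBs β ho' he3'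
        exact ⟨fun e he hf => (hled₁ e he hf).symm, hform₁, fun e he hdeg => (hstr₁ e he hdeg).trans (ResCone.cone_comm_sigma la ℓ u f n d)⟩
    obtain ⟨hled₁, hform₁, hstr₁⟩ := hframe
    have hM5 : M - p * q - p = M - p * (q + 1) := by omega
    rw [hM5] at hrel'
    rw [← hℓq] at hrel' ho' hr' hdiv' hiso' he3' hled₁ hform₁ hstr₁
    rw [← hπq] at hrel' hrA'
    exact ⟨β, hrel', hrA', ho', hr', hdiv', hform₁, hstr₁, hled₁, hiso', he3'⟩
  -- extend-and-update induction on the number of steps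
  have main : ∀ q, q ≤ T + 1 → ∃ (Bs : ℕ → State K) (βs : ℕ → K), Bs 0 = B₀ ∧
      (∀ t, t < q → Bs (t + 1) = CentreBlowup.step p Finset.univ (ℓs t) (Function.update (0 : Fin 4 → K) u (βs t)) (Bs t)) ∧
      ∀ t, t ≤ q →
        (∃ (θ e : Fin 4 → MvPolynomial (Fin 4) K) (U E : MvPolynomial (Fin 4) K),
          θ (πs t la) = X la * e la ∧ θ (πs t mu) = X mu * e mu ∧ constantCoeff (e la) ≠ 0 ∧ constantCoeff (e mu) ≠ 0 ∧
          constantCoeff (θ (πs t u)) = 0 ∧ constantCoeff (θ (πs t f)) = 0 ∧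
          coeff (Finsupp.single u 1) (θ (πs t u)) * coeff (Finsupp.single f 1) (θ (πs t f)) -
            coeff (Finsupp.single f 1) (θ (πs t u)) * coeff (Finsupp.single u 1) (θ (πs t f)) ≠ 0 ∧
          constantCoeff U ≠ 0 ∧ E ∈ originIdeal K ^ (M - p * t) ∧
          (Bs t).F = deletePthPowers p (U ^ p * aeval θ (c (k + t)).F) + E) ∧
        (c (k + t)).r = Finsupp.single (πs t la) n + Finsupp.single (πs t mu) n ∧
        (ordZero (Bs t).F = ((p + n : ℕ) : ℕ∞) ∧ (Bs t).r = Finsupp.single la n + Finsupp.single mu n ∧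
          (∀ e ∈ (Bs t).F.support, (Bs t).r ≤ e) ∧ (∃ a : K, a ≠ 0 ∧ ResCone.resForm (Bs t) = C a * X f ^ d) ∧
          (∀ e ∈ (Bs t).F.support, e.degree = p + n →
            e = Finsupp.single la n + Finsupp.single mu n + Finsupp.single u 0 + Finsupp.single f d) ∧
          (∀ e ∈ (Bs t).F.support, e f ≤ d - 1 → n + 1 ≤ e la ∧ n + 1 ≤ e mu) ∧
          IsIsolated p (Bs t).F ∧ Module.finrank K (ResCone.resVertex (Bs t)) = 3) := by
    intro q
    induction q with
    | zero =>
      intro _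
      refine ⟨fun _ => B₀, fun _ => 0, rfl, fun t ht => absurd ht (Nat.not_lt_zero t), fun t ht => ?_⟩
      obtain rfl : t = 0 := Nat.le_zero.mp ht
      simp only [Nat.mul_zero, Nat.sub_zero, Nat.add_zero]
      rw [hπ0]
      exact ⟨hrel0, hrA0, hfr0⟩
    | succ q ih =>
      intro hqT
      obtain ⟨Bs, βs, hB0, hstepS, hpack⟩ := ih (by omega)
      obtain ⟨hrel, hrA, hfr⟩ := hpack q le_rfl
      obtain ⟨β, hrel', hrA', hfr'⟩ := hone q (by omega) (Bs q) hrel hrA hfr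
      refine ⟨Function.update Bs (q + 1) (CentreBlowup.step p Finset.univ (ℓs q) (Function.update (0 : Fin 4 → K) u β) (Bs q)),
        Function.update βs q β, ?_, fun t ht => ?_, fun t ht => ?_⟩
      · rw [Function.update_of_ne (Nat.succ_ne_zero q).symm, hB0]
      · rcases Nat.lt_succ_iff_lt_or_eq.mp ht with hlt | rfl
        · rw [Function.update_of_ne (by omega : t + 1 ≠ q + 1), Function.update_of_ne (by omega : t ≠ q + 1),
            Function.update_of_ne (by omega : t ≠ q)]
          exact hstepS t hlt
        · rw [Function.update_self, Function.update_of_ne (by omega : t ≠ t + 1), Function.update_self]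
      · rcases Nat.lt_or_ge t (q + 1) with hlt | hge
        · rw [Function.update_of_ne (by omega : t ≠ q + 1)]
          exact hpack t (by omega)
        · obtain rfl : t = q + 1 := le_antisymm ht hge
          rw [Function.update_self]
          exact ⟨hrel', hrA', hfr'⟩
  obtain ⟨Bs, βs, hB0, hstepS, hpack⟩ := main (T + 1) le_rfl
  exact ⟨πs, Bs, ℓs, βs, hπ0, hB0, hℓs, hπs, fun t ht => hstepS t (by omega), hpack⟩

end SwapTransport

end Summit.ResolutionOfSingularities.ResolutionOfSingularities.Theorems.PIDim4

end
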